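import Summits.KontsevichZagierPeriods.KontsevichZagierPeriods.Theorems.UnfoldedStokesCubeKernelStepStubPrimitiveCompression
import Summits.KontsevichZagierPeriods.KontsevichZagierPeriods.Theorems.UnfoldedStokesCubeKernelStepStubDerivativeSubLayer
import Summits.KontsevichZagierPeriods.KontsevichZagierPeriods.Theorems.UnfoldedStokesCubeKernelStepStubFibreNullFiniteRankIndep
import Summits.KontsevichZagierPeriods.KontsevichZagierPeriods.Theorems.UnfoldedStokesCubeKernelStepStubFibreNullPolynomial
import Summits.KontsevichZagierPeriods.KontsevichZagierPeriods.Theorems.UnfoldedStokesStokesGenerationStubValueOneCoord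

/-!
# `CubeKernelStep` (stmt-KontsevichZagierPeriods-17854), line `Sketch`:
# stub `stub_derivativeMarginal`

The RUNG stub `stub_derivativeMarginal` (a K2-instance; verbatim the crux-strategist's rung of
`Lines/three_sectors.lean`) of the skeleton `Cruxes/CubeKernelStep/Lines/Sketch.lean` of the crux
`CubeKernelStep` (route UnfoldedStokes): under the lower layers `K(≤d)` (`d ≥ 1`), a continuous
closed `(d+1)`-cube representation `t` of value `0` whose marginal `V = sliceValue t` has within
`[0,1]` a derivative `w` continuous and `ℚ`-semialgebraic on `[0,1]` is congruent modulo
`KZ.relations` to a continuous FIBRE-NULL closed `(d+1)`-cube representation `t'`.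

Proof. WITNESS `t'(z) = t(z) − t(update z 0 0) − z 0 · w(z 0 · z 1)`. (A) `t'` is fibre-null: for
`s ∈ [0,1]` its slice integrals are `V(s)`, `V(0)` and `∫_{[0,1]^d} s·w(s·x 0) dx = ∫₀ˢ w`
(Fubini on the cube in one coordinate, substitution `v = s u`), and `V(s) − V(0) = ∫₀ˢ w` (FTC);
hence `t'.value = 0`. (B) Integrand additivity (rule (1)): `[t] − [t'] ≡ [g₁] + [g₂]` with
`g₁ = [□^{d+1}, t(update z 0 0)]`, `g₂ = [□^{d+1}, z 0 · w(z 0 · z 1)]`, so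
`g₁.value + g₂.value = 0` (soundness). (C) `g₁ ≡ h₁ = [□^d, ·]` (silent coordinate `0`:
transposition `(0 last)`, rule (2), `exists_liftCube_succ`, rule (3), congruence);
`g₂ ≡ [□², p 0 · w(p 0 · p 1)] ≡ [[0,1], (1 − u) w(u)]` (the LANDED `stub_primitiveCompression`,
`k = 0`) `≡ h₂ = [□^d, ·]` (`exists_liftCube`); merging `H = [□^d, h₁ + h₂]` (rule (1)) gives a
continuous `d`-cube representation of value `g₁.value + g₂.value = 0`, killed by `K(≤d)`.
[Kontsevich–Zagier 2001, §1.2 rules (1)–(3)]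
-/

noncomputable section

set_option linter.dupNamespace false

namespace Summit.KontsevichZagierPeriods.KontsevichZagierPeriods.Cruxes.CubeKernelStep.Layers

open MeasureTheory Set
open Literature.ModelTheory.ExponentialFields (IsSemialgebraic)
open Literature.NumberTheory.Transcendental
open Literature.NumberTheory.Transcendental.KZ
open Summit.KontsevichZagierPeriods.KontsevichZagierPeriods.Cruxes.StokesGeneration.FibrewiseStokes
  (setOf_comp_perm_mem_cubePi update_mem_cubePi setIntegral_cubePi_comp_eval_eq_intervalIntegral)
open Summit.KontsevichZagierPeriods.KontsevichZagierPeriods.StokesGenerationLine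
  (exists_liftCube exists_liftCube_succ face_semialgebraic_continuousOn snoc_init_eq_update
    isSemialgebraic_cubePi isSemialgebraicMapOn_update)

/-- A product of two numbers of `[0,1]` lies in `[0,1]`. [folklore] -/
theorem derivMarg_mul_mem_Icc {a b : ℝ} (ha : a ∈ Set.Icc (0:ℝ) 1) (hb : b ∈ Set.Icc (0:ℝ) 1) :
    a * b ∈ Set.Icc (0:ℝ) 1 :=
  ⟨mul_nonneg ha.1 hb.1, mul_le_one₀ ha.2 hb.1 hb.2⟩

/-- The point of `ℝ¹` with coordinate in `[0,1]` lies in the closed `1`-cube. [folklore] -/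
theorem derivMarg_const_mem_cubePi_one {a : ℝ} (ha : a ∈ Set.Icc (0:ℝ) 1) :
    (fun _ : Fin 1 => a) ∈ Set.pi Set.univ (fun _ : Fin 1 => Set.Icc (0:ℝ) 1) :=
  Set.mem_univ_pi.mpr fun _ => ha

/-- `vecCons c x` lies in the closed `(d+1)`-cube when `c ∈ [0,1]` and `x ∈ [0,1]^d`. [folklore] -/
theorem derivMarg_vecCons_mem_cubePi {d : ℕ} {c : ℝ} (hc : c ∈ Set.Icc (0:ℝ) 1) {x : Fin d → ℝ}
    (hx : x ∈ Set.pi Set.univ (fun _ : Fin d => Set.Icc (0:ℝ) 1)) :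
    (Matrix.vecCons c x : Fin (d + 1) → ℝ) ∈
      Set.pi Set.univ (fun _ : Fin (d + 1) => Set.Icc (0:ℝ) 1) := by
  simp only [Set.mem_univ_pi, Fin.forall_fin_succ, Matrix.cons_val_zero, Matrix.cons_val_succ]
  exact ⟨hc, fun k => (Set.mem_univ_pi.mp hx) k⟩

/-- `z ↦ z i · w(z i · z j)` is `ℚ`-semialgebraic (composition of `w` with a polynomial map into
`[0,1]`, Tarski–Seidenberg) and continuous on the closed cube.
[cite: BochnakCosteRoy1998, Prop. 2.2.6] -/
theorem derivMarg_corr {n : ℕ} {w : (Fin 1 → ℝ) → ℝ}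
    (hwc : ContinuousOn w (Set.pi Set.univ (fun _ : Fin 1 => Set.Icc (0:ℝ) 1)))
    (hws : IsSemialgebraicFunOn ℚ (Set.pi Set.univ (fun _ : Fin 1 => Set.Icc (0:ℝ) 1)) w)
    (i j : Fin n) :
    IsSemialgebraicFunOn ℚ (Set.pi Set.univ (fun _ : Fin n => Set.Icc (0:ℝ) 1))
        (fun z => z i * w (fun _ : Fin 1 => z i * z j)) ∧
      ContinuousOn (fun z : Fin n → ℝ => z i * w (fun _ : Fin 1 => z i * z j))
        (Set.pi Set.univ (fun _ : Fin n => Set.Icc (0:ℝ) 1)) := by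
  have hQ : IsSemialgebraic ℚ (Set.pi Set.univ (fun _ : Fin n => Set.Icc (0:ℝ) 1)) :=
    isSemialgebraic_cubePi n
  have hmem : ∀ z ∈ Set.pi Set.univ (fun _ : Fin n => Set.Icc (0:ℝ) 1),
      (fun _ : Fin 1 => z i * z j) ∈ Set.pi Set.univ (fun _ : Fin 1 => Set.Icc (0:ℝ) 1) :=
    fun z hz => derivMarg_const_mem_cubePi_one
      (derivMarg_mul_mem_Icc (Set.mem_univ_pi.mp hz i) (Set.mem_univ_pi.mp hz j))
  have hmap : IsSemialgebraicMapOn ℚ (Set.pi Set.univ (fun _ : Fin n => Set.Icc (0:ℝ) 1))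
      (fun (z : Fin n → ℝ) (_ : Fin 1) => z i * z j) :=
    (isSemialgebraicMapOn_aeval hQ
      (fun _ : Fin 1 => (MvPolynomial.X i * MvPolynomial.X j : MvPolynomial (Fin n) ℚ))).congr
      fun z _ => funext fun _ => by simp
  have hγ : Continuous fun (z : Fin n → ℝ) (_ : Fin 1) => z i * z j :=
    continuous_pi fun _ => (continuous_apply i).mul (continuous_apply j)
  exact ⟨(isSemialgebraicFunOn_apply hQ i).fun_mul
      (IsSemialgebraicFunOn.comp_isSemialgebraicMapOn_holds hws hmap hmem),
    (continuous_apply i).continuousOn.mul (hwc.comp hγ.continuousOn hmem)⟩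

/-- `z ↦ F (update z i 0)` is `ℚ`-semialgebraic and continuous on the closed cube if `F` is
(composition with a polynomial self-map of the cube). [cite: BochnakCosteRoy1998, Prop. 2.2.6] -/
theorem derivMarg_update {n : ℕ} {F : (Fin n → ℝ) → ℝ}
    (hF : IsSemialgebraicFunOn ℚ (Set.pi Set.univ (fun _ : Fin n => Set.Icc (0:ℝ) 1)) F)
    (hFc : ContinuousOn F (Set.pi Set.univ (fun _ : Fin n => Set.Icc (0:ℝ) 1))) (i : Fin n) :
    IsSemialgebraicFunOn ℚ (Set.pi Set.univ (fun _ : Fin n => Set.Icc (0:ℝ) 1))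
        (fun z => F (Function.update z i 0)) ∧
      ContinuousOn (fun z => F (Function.update z i 0))
        (Set.pi Set.univ (fun _ : Fin n => Set.Icc (0:ℝ) 1)) := by
  have hmap : IsSemialgebraicMapOn ℚ (Set.pi Set.univ (fun _ : Fin n => Set.Icc (0:ℝ) 1))
      (fun z : Fin n → ℝ => Function.update z i (0:ℝ)) := by
    simpa only [Rat.cast_zero] using isSemialgebraicMapOn_update (M := n) i (0:ℚ)
  have hγ : Continuous fun z : Fin n → ℝ => Function.update z i (0:ℝ) :=
    continuous_id.update i continuous_const
  exact ⟨IsSemialgebraicFunOn.comp_isSemialgebraicMapOn_holds hF hmap fun z hz =>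
      update_mem_cubePi hz i ⟨le_rfl, zero_le_one⟩,
    hFc.comp hγ.continuousOn fun _ hz => update_mem_cubePi hz i ⟨le_rfl, zero_le_one⟩⟩

/-- A continuous `ℚ`-semialgebraic function on the closed cube is the integrand of a closed-cube
representation (absolute integrability: continuity on a compact set).
[cite: KontsevichZagier2001, §1.1] -/
theorem derivMarg_exists_rep {n : ℕ} {f : (Fin n → ℝ) → ℝ}
    (hs : IsSemialgebraicFunOn ℚ (Set.pi Set.univ (fun _ : Fin n => Set.Icc (0:ℝ) 1)) f)
    (hc : ContinuousOn f (Set.pi Set.univ (fun _ : Fin n => Set.Icc (0:ℝ) 1))) :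
    ∃ r : IntegralRep n, r.domain = Set.pi Set.univ (fun _ : Fin n => Set.Icc (0:ℝ) 1) ∧
      r.integrand = f :=
  ⟨⟨_, f, isSemialgebraic_cubePi n, hs,
    hc.integrableOn_compact (isCompact_univ_pi fun _ => isCompact_Icc)⟩, rfl, rfl⟩

/-- The correction term has slice `∫_{[0,1]^n} s · w(s · x i) dx = ∫₀ˢ w` for `s ∈ [0,1]`
(Fubini on the cube in the coordinate `i`, then the substitution `v = s u`). [folklore] -/
theorem derivMarg_integral_corr {n : ℕ} {w : (Fin 1 → ℝ) → ℝ}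
    (hwc : ContinuousOn w (Set.pi Set.univ (fun _ : Fin 1 => Set.Icc (0:ℝ) 1))) (i : Fin n)
    {s : ℝ} (hs : s ∈ Set.Icc (0:ℝ) 1) :
    ∫ x in Set.pi Set.univ (fun _ : Fin n => Set.Icc (0:ℝ) 1), s * w (fun _ : Fin 1 => s * x i) =
      ∫ v in (0:ℝ)..s, w (fun _ : Fin 1 => v) := by
  have hγ : Continuous fun (u : ℝ) (_ : Fin 1) => s * u :=
    continuous_pi fun _ => continuous_const.mul continuous_id
  have hg : ContinuousOn (fun u : ℝ => w (fun _ : Fin 1 => s * u)) (Set.Icc (0:ℝ) 1) :=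
    hwc.comp hγ.continuousOn fun u hu =>
      derivMarg_const_mem_cubePi_one (derivMarg_mul_mem_Icc hs hu)
  have h1 : ∫ x in Set.pi Set.univ (fun _ : Fin n => Set.Icc (0:ℝ) 1),
      w (fun _ : Fin 1 => s * x i) = ∫ u in (0:ℝ)..1, w (fun _ : Fin 1 => s * u) :=
    setIntegral_cubePi_comp_eval_eq_intervalIntegral i hg
  have h2 : s * ∫ u in (0:ℝ)..1, w (fun _ : Fin 1 => s * u) =
      ∫ v in (0:ℝ)..s, w (fun _ : Fin 1 => v) := by
    simpa only [mul_zero, mul_one] using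
      intervalIntegral.mul_integral_comp_mul_left (f := fun v => w (fun _ : Fin 1 => v))
        (a := 0) (b := 1) s
  rw [integral_const_mul, h1, h2]

/-- **Fundamental theorem of calculus for the marginal**: if `V` has derivative `w(s)` within
`[0,1]` at every `s ∈ [0,1]`, with `w` continuous on `[0,1]`, then `∫₀ˢ w = V s − V 0` for
`s ∈ [0,1]`. [folklore] -/
theorem derivMarg_ftc {V : ℝ → ℝ} {w : (Fin 1 → ℝ) → ℝ}
    (hwc : ContinuousOn w (Set.pi Set.univ (fun _ : Fin 1 => Set.Icc (0:ℝ) 1)))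
    (hV : ∀ s ∈ Set.Icc (0:ℝ) 1,
      HasDerivWithinAt V (w (fun _ : Fin 1 => s)) (Set.Icc (0:ℝ) 1) s)
    {s : ℝ} (hs : s ∈ Set.Icc (0:ℝ) 1) :
    ∫ v in (0:ℝ)..s, w (fun _ : Fin 1 => v) = V s - V 0 := by
  have hcont : ContinuousOn V (Set.Icc 0 s) := fun x hx =>
    ((hV x ⟨hx.1, hx.2.trans hs.2⟩).continuousWithinAt).mono (Set.Icc_subset_Icc_right hs.2)
  have hderiv : ∀ x ∈ Set.Ioo 0 s, HasDerivAt V (w (fun _ : Fin 1 => x)) x := fun x hx =>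
    (hV x ⟨hx.1.le, (hx.2.trans_le hs.2).le⟩).hasDerivAt (Icc_mem_nhds hx.1 (hx.2.trans_le hs.2))
  have hγ : Continuous fun (v : ℝ) (_ : Fin 1) => v := continuous_pi fun _ => continuous_id
  have hint : IntervalIntegrable (fun v => w (fun _ : Fin 1 => v)) volume 0 s := by
    refine ContinuousOn.intervalIntegrable ?_
    rw [Set.uIcc_of_le hs.1]
    exact hwc.comp hγ.continuousOn fun v hv =>
      derivMarg_const_mem_cubePi_one ⟨hv.1, hv.2.trans hs.2⟩
  exact intervalIntegral.integral_eq_sub_of_hasDerivAt_of_le hs.1 hcont hderiv hint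

/-- **The witness is fibre-null.** With `V = sliceValue t` and `V' = w` within `[0,1]`, the
closed-cube representation `t'` with integrand `t(z) − t(update z 0 0) − z 0 · w(z 0 · z i.succ)`
has slice value `V(s) − V(0) − ∫₀ˢ w = 0` at every `s ∈ [0,1]`.
[cite: KontsevichZagier2001, §1.2] -/
theorem derivMarg_sliceValue_witness {d : ℕ} (t t' : IntegralRep (d + 1)) (i : Fin d)
    (w : (Fin 1 → ℝ) → ℝ)
    (htd : t.domain = Set.pi Set.univ (fun _ : Fin (d + 1) => Set.Icc (0:ℝ) 1))
    (htc : ContinuousOn t.integrand t.domain)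
    (hwc : ContinuousOn w (Set.pi Set.univ (fun _ : Fin 1 => Set.Icc (0:ℝ) 1)))
    (hV : ∀ s ∈ Set.Icc (0:ℝ) 1,
      HasDerivWithinAt (sliceValue t) (w (fun _ : Fin 1 => s)) (Set.Icc (0:ℝ) 1) s)
    (ht'd : t'.domain = Set.pi Set.univ (fun _ : Fin (d + 1) => Set.Icc (0:ℝ) 1))
    (ht'i : t'.integrand = fun z => t.integrand z - t.integrand (Function.update z 0 0) -
      z 0 * w (fun _ : Fin 1 => z 0 * z i.succ))
    {s : ℝ} (hs : s ∈ Set.Icc (0:ℝ) 1) : sliceValue t' s = 0 := by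
  have hmeas : MeasurableSet (Set.pi Set.univ (fun _ : Fin d => Set.Icc (0:ℝ) 1)) :=
    MeasurableSet.univ_pi fun _ => measurableSet_Icc
  have hQc : IsCompact (Set.pi Set.univ (fun _ : Fin d => Set.Icc (0:ℝ) 1)) :=
    isCompact_univ_pi fun _ => isCompact_Icc
  have h0 : (0:ℝ) ∈ Set.Icc (0:ℝ) 1 := ⟨le_rfl, zero_le_one⟩
  rw [htd] at htc
  have hcs : ∀ {c : ℝ}, c ∈ Set.Icc (0:ℝ) 1 →
      ContinuousOn (fun x : Fin d → ℝ => t.integrand (Matrix.vecCons c x))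
        (Set.pi Set.univ (fun _ : Fin d => Set.Icc (0:ℝ) 1)) := fun hc =>
    htc.comp (continuous_const.matrixVecCons continuous_id).continuousOn
      fun x hx => derivMarg_vecCons_mem_cubePi hc hx
  have hγ : Continuous fun (x : Fin d → ℝ) (_ : Fin 1) => s * x i :=
    continuous_pi fun _ => continuous_const.mul (continuous_apply i)
  have hc3 : ContinuousOn (fun x : Fin d → ℝ => s * w (fun _ : Fin 1 => s * x i))
      (Set.pi Set.univ (fun _ : Fin d => Set.Icc (0:ℝ) 1)) :=
    continuousOn_const.mul (hwc.comp hγ.continuousOn fun x hx =>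
      derivMarg_const_mem_cubePi_one (derivMarg_mul_mem_Icc hs (Set.mem_univ_pi.mp hx i)))
  have hEq : EqOn (fun x : Fin d → ℝ => t'.integrand (Matrix.vecCons s x))
      (fun x => t.integrand (Matrix.vecCons s x) - t.integrand (Matrix.vecCons 0 x) -
        s * w (fun _ : Fin 1 => s * x i))
      (Set.pi Set.univ (fun _ : Fin d => Set.Icc (0:ℝ) 1)) := by
    intro x _
    simp only [ht'i, Matrix.vecCons, Fin.update_cons_zero, Fin.cons_zero, Fin.cons_succ]
  have hI12 : IntegrableOn
      (fun x : Fin d → ℝ => t.integrand (Matrix.vecCons s x) - t.integrand (Matrix.vecCons 0 x))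
      (Set.pi Set.univ (fun _ : Fin d => Set.Icc (0:ℝ) 1)) :=
    ((hcs hs).integrableOn_compact hQc).sub ((hcs h0).integrableOn_compact hQc)
  rw [sliceValue_def, finRank_slice_eq_cube t' ht'd hs, setIntegral_congr_fun hmeas hEq,
    integral_sub hI12 (hc3.integrableOn_compact hQc),
    integral_sub ((hcs hs).integrableOn_compact hQc) ((hcs h0).integrableOn_compact hQc),
    derivMarg_integral_corr hwc i hs, derivMarg_ftc hwc hV hs, sliceValue_def, sliceValue_def,
    finRank_slice_eq_cube t htd hs, finRank_slice_eq_cube t htd h0]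
  ring

/-- RUNG (a K2-instance; VERBATIM the crux-strategist's rung of `Lines/three_sectors.lean`) of
crux `CubeKernelStep`, line `Sketch`: **a marginal with a semialgebraic derivative is realised and
removed inside dimension `d+1`.** Under `K(≤d)` (`d ≥ 1`): if `t` is a continuous closed
`(d+1)`-cube representation of value `0` whose marginal `V = sliceValue t` has, within `[0,1]`, a
derivative `w` that is continuous and `ℚ`-semialgebraic on `[0,1]`, then `t` is congruent modulo
`relations` to a continuous fibre-null closed `(d+1)`-cube representation. Witness:
`t'(z) := t(z) − t(update z 0 0) − z 0 · w(z 0 · z 1)` (slices `V(s) − V(0) − ∫₀ˢ w = 0`, FTC);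
`[t] − [t']` is, by integrand additivity, silent-variable removal (transposition + lifting moves)
and the LANDED `stub_primitiveCompression` (`k = 0`), congruent to one continuous `d`-cube
representation of value `t.value − t'.value = 0` (soundness), killed by `K(≤d)`.
[cite: KontsevichZagier2001, §1.2 rules (1), (2), (3)] -/
theorem stub_derivativeMarginal :
    ∀ d : ℕ, 1 ≤ d →
      (∀ (M : ℕ), M ≤ d → ∀ (a : IntegralRep M),
        a.domain = Set.pi Set.univ (fun _ : Fin M => Set.Icc (0:ℝ) 1) →
        ContinuousOn a.integrand a.domain → a.value = 0 → of a ∈ relations) →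
      ∀ (t : IntegralRep (d + 1)) (w : (Fin 1 → ℝ) → ℝ),
        t.domain = Set.pi Set.univ (fun _ : Fin (d + 1) => Set.Icc (0:ℝ) 1) →
        ContinuousOn t.integrand t.domain → t.value = 0 →
        ContinuousOn w (Set.pi Set.univ (fun _ : Fin 1 => Set.Icc (0:ℝ) 1)) →
        IsSemialgebraicFunOn ℚ (Set.pi Set.univ (fun _ : Fin 1 => Set.Icc (0:ℝ) 1)) w →
        (∀ s ∈ Set.Icc (0:ℝ) 1,
          HasDerivWithinAt (sliceValue t) (w (fun _ : Fin 1 => s)) (Set.Icc (0:ℝ) 1) s) →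
        ∃ t' : IntegralRep (d + 1),
          t'.domain = Set.pi Set.univ (fun _ : Fin (d + 1) => Set.Icc (0:ℝ) 1) ∧
          ContinuousOn t'.integrand t'.domain ∧
          (∀ s ∈ Set.Icc (0:ℝ) 1, sliceValue t' s = 0) ∧
          of t - of t' ∈ relations := by
  intro d hd hK t w htd htc hval hwc hws hV
  classical
  have htS : IsSemialgebraicFunOn ℚ (Set.pi Set.univ (fun _ : Fin (d + 1) => Set.Icc (0:ℝ) 1))
      t.integrand := by
    rw [← htd]; exact t.isSemialgebraicFunOn_integrand
  have htC : ContinuousOn t.integrand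
      (Set.pi Set.univ (fun _ : Fin (d + 1) => Set.Icc (0:ℝ) 1)) := by
    rw [← htd]; exact htc
  -- the witness `t'`, the two removed pieces `g₁`, `g₂` and their sum `u` (the fibre
  -- coordinate `x 0` of `[0,1]^d` is the coordinate `(⟨0, hd⟩ : Fin d).succ` of the total space)
  obtain ⟨hg₁S, hg₁C⟩ := derivMarg_update htS htC (0 : Fin (d + 1))
  obtain ⟨hg₂S, hg₂C⟩ := derivMarg_corr hwc hws (0 : Fin (d + 1)) (Fin.succ ⟨0, hd⟩)
  obtain ⟨t', ht'd, ht'i⟩ :=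
    derivMarg_exists_rep ((htS.fun_sub hg₁S).fun_sub hg₂S) ((htC.sub hg₁C).sub hg₂C)
  obtain ⟨g₁, hg₁d, hg₁i⟩ := derivMarg_exists_rep hg₁S hg₁C
  obtain ⟨g₂, hg₂d, hg₂i⟩ := derivMarg_exists_rep hg₂S hg₂C
  obtain ⟨u, hud, hui⟩ := derivMarg_exists_rep (hg₁S.fun_add hg₂S) (hg₁C.add hg₂C)
  -- (A) the witness is fibre-null, hence of value `0`
  have hfn : ∀ s ∈ Set.Icc (0:ℝ) 1, sliceValue t' s = 0 := fun s hs =>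
    derivMarg_sliceValue_witness t t' ⟨0, hd⟩ w htd htc hwc hV ht'd ht'i hs
  have ht'val : t'.value = 0 := value_eq_zero_of_sliceValue_eq_zero t' ht'd hfn
  have ht'C : ContinuousOn t'.integrand t'.domain := by
    rw [ht'd, ht'i]; exact (htC.sub hg₁C).sub hg₂C
  refine ⟨t', ht'd, ht'C, hfn, ?_⟩
  -- (B) integrand additivity: `[t] − [t'] ≡ [g₁] + [g₂]`, a combination of value `0`
  have e1 : of t - of t' - of u ∈ relations :=
    integrandAddRel_subset_relations ⟨d + 1, t, t', u, ht'd.trans htd.symm, hud.trans htd.symm,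
      fun x _ => by simp only [ht'i, hui, Pi.add_apply]; ring, rfl⟩
  have e2 : of u - of g₁ - of g₂ ∈ relations :=
    integrandAddRel_subset_relations ⟨d + 1, u, g₁, g₂, hg₁d.trans hud.symm, hg₂d.trans hud.symm,
      fun x _ => by simp only [hui, hg₁i, hg₂i, Pi.add_apply], rfl⟩
  -- (C1) the silent coordinate `0` of `g₁`: transposition `(0 last)`, face, lift: `[g₁] ≡ [h₁]`
  obtain ⟨e, he0⟩ : ∃ e : Equiv.Perm (Fin (d + 1)), e 0 = Fin.last d :=
    ⟨Equiv.swap 0 (Fin.last d), Equiv.swap_apply_left _ _⟩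
  have hesymm : e.symm (Fin.last d) = 0 := by rw [← he0, Equiv.symm_apply_apply]
  have hupd : ∀ (x : Fin (d + 1) → ℝ) (c : ℝ),
      (fun j => Function.update x (Fin.last d) c (e j)) =
        Function.update (fun j => x (e j)) 0 c := by
    intro x c
    funext j
    rw [Function.update_apply_equiv_apply, hesymm]
    rfl
  set G₁ : IntegralRep (d + 1) := g₁.reindex e with hG₁
  have eG : of g₁ - of G₁ ∈ relations := of_sub_of_reindex_mem_relations g₁ e
  have hG₁d : G₁.domain = Set.pi Set.univ (fun _ : Fin (d + 1) => Set.Icc (0:ℝ) 1) := by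
    rw [hG₁, IntegralRep.reindex_domain, hg₁d]
    exact setOf_comp_perm_mem_cubePi e
  have hG₁i : ∀ x, G₁.integrand x = t.integrand (Function.update (fun j => x (e j)) 0 0) := by
    intro x
    rw [hG₁, IntegralRep.reindex_integrand, hg₁i]
  have hG₁S : IsSemialgebraicFunOn ℚ (Set.pi Set.univ (fun _ : Fin (d + 1) => Set.Icc (0:ℝ) 1))
      G₁.integrand := by
    rw [← hG₁d]; exact G₁.isSemialgebraicFunOn_integrand
  have hLc : Continuous fun (x : Fin (d + 1) → ℝ) (j : Fin (d + 1)) => x (e j) :=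
    continuous_pi fun j => continuous_apply (e j)
  have hmemQ : ∀ x ∈ Set.pi Set.univ (fun _ : Fin (d + 1) => Set.Icc (0:ℝ) 1),
      (fun j => x (e j)) ∈ Set.pi Set.univ (fun _ : Fin (d + 1) => Set.Icc (0:ℝ) 1) :=
    fun x hx j _ => hx (e j) (Set.mem_univ _)
  have hG₁C : ContinuousOn G₁.integrand
      (Set.pi Set.univ (fun _ : Fin (d + 1) => Set.Icc (0:ℝ) 1)) :=
    (hg₁C.comp hLc.continuousOn hmemQ).congr fun x _ => hG₁i x
  have hsilent : ∀ x, G₁.integrand (Function.update x (Fin.last d) 0) = G₁.integrand x := by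
    intro x
    simp only [hG₁i, hupd, Function.update_idem]
  have hCQ : cube (d + 1) ⊆ Set.pi Set.univ (fun _ : Fin (d + 1) => Set.Icc (0:ℝ) 1) :=
    (cube_eq_pi (d + 1)).le
  obtain ⟨hs0, hc0⟩ := face_semialgebraic_continuousOn hCQ hG₁S hG₁C 0 ⟨0, Rat.cast_zero⟩
    ⟨le_rfl, zero_le_one⟩
  let h₁ : IntegralRep d := ⟨cube d, fun y => G₁.integrand (Fin.snoc y 0), isSemialgebraic_cube,
    hs0, hc0.integrableOn_compact isCompact_cube⟩
  have hh₁d : h₁.domain = Set.pi Set.univ (fun _ : Fin d => Set.Icc (0:ℝ) 1) := cube_eq_pi d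
  have hh₁S : IsSemialgebraicFunOn ℚ (Set.pi Set.univ (fun _ : Fin d => Set.Icc (0:ℝ) 1))
      h₁.integrand := by
    rw [← cube_eq_pi]; exact hs0
  have hh₁C : ContinuousOn h₁.integrand (Set.pi Set.univ (fun _ : Fin d => Set.Icc (0:ℝ) 1)) := by
    rw [← cube_eq_pi]; exact hc0
  obtain ⟨T₁, hT₁d, hT₁i, eT⟩ := exists_liftCube_succ d h₁ hh₁d
  have e6 : of G₁ - of T₁ ∈ relations := by
    refine of_sub_of_mem_relations_of_eqOn (hT₁d.trans hG₁d.symm) fun x hx => ?_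
    rw [hG₁d] at hx
    rw [hT₁i x hx]
    show G₁.integrand x = G₁.integrand (Fin.snoc (Fin.init x) 0)
    rw [snoc_init_eq_update, hsilent]
  -- (C2) the correction `g₂`: silent coordinates `2, …, d`, compression (`k = 0`), lift
  have h2le : 2 ≤ d + 1 := by omega
  obtain ⟨hr₂S, hr₂C⟩ := derivMarg_corr hwc hws (0 : Fin 2) 1
  obtain ⟨r₂, hr₂d, hr₂i⟩ := derivMarg_exists_rep hr₂S hr₂C
  obtain ⟨L₂, hL₂d, hL₂i, e4⟩ := exists_liftCube 2 (d + 1) h2le r₂ hr₂d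
  have hκ0 : (Fin.castLE h2le 0 : Fin (d + 1)) = 0 := Fin.ext rfl
  have hκ1 : (Fin.castLE h2le 1 : Fin (d + 1)) = Fin.succ ⟨0, hd⟩ := Fin.ext rfl
  have e5 : of g₂ - of L₂ ∈ relations := by
    refine of_sub_of_mem_relations_of_eqOn (hL₂d.trans hg₂d.symm) fun x hx => ?_
    rw [hg₂d] at hx
    rw [hL₂i x hx, hg₂i, hr₂i]
    simp only [hκ0, hκ1]
  have hQ1 : IsSemialgebraic ℚ (Set.pi Set.univ (fun _ : Fin 1 => Set.Icc (0:ℝ) 1)) :=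
    isSemialgebraic_cubePi 1
  have h1S : IsSemialgebraicFunOn ℚ (Set.pi Set.univ (fun _ : Fin 1 => Set.Icc (0:ℝ) 1))
      (fun y => (1 - y 0) * w y) := by
    have h1 : IsSemialgebraicFunOn ℚ (Set.pi Set.univ (fun _ : Fin 1 => Set.Icc (0:ℝ) 1))
        (fun _ => (1:ℝ)) := by
      simpa using isSemialgebraicFunOn_const_ratCast hQ1 1
    exact (h1.fun_sub (isSemialgebraicFunOn_apply hQ1 0)).fun_mul hws
  have h1C : ContinuousOn (fun y : Fin 1 → ℝ => (1 - y 0) * w y)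
      (Set.pi Set.univ (fun _ : Fin 1 => Set.Icc (0:ℝ) 1)) :=
    (continuous_const.sub (continuous_apply 0)).continuousOn.mul hwc
  obtain ⟨r₁, hr₁d, hr₁i⟩ := derivMarg_exists_rep h1S h1C
  have e3 : of r₂ - of r₁ ∈ relations :=
    stub_primitiveCompression 0 w hwc hws r₂ r₁ hr₂d (fun z _ => by simp [hr₂i]) hr₁d
      (fun y _ => by simp [hr₁i])
  obtain ⟨h₂, hh₂d, hh₂i, e7⟩ := exists_liftCube 1 d hd r₁ hr₁d
  have hMc : Continuous fun (y : Fin d → ℝ) (l : Fin 1) => y (Fin.castLE hd l) :=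
    continuous_pi fun l => continuous_apply (Fin.castLE hd l)
  have hmem1 : ∀ y ∈ Set.pi Set.univ (fun _ : Fin d => Set.Icc (0:ℝ) 1),
      (fun l => y (Fin.castLE hd l)) ∈ Set.pi Set.univ (fun _ : Fin 1 => Set.Icc (0:ℝ) 1) :=
    fun y hy l _ => hy (Fin.castLE hd l) (Set.mem_univ _)
  have hwM : ContinuousOn (fun y : Fin d → ℝ => w (fun l => y (Fin.castLE hd l)))
      (Set.pi Set.univ (fun _ : Fin d => Set.Icc (0:ℝ) 1)) := hwc.comp hMc.continuousOn hmem1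
  have hh₂C : ContinuousOn h₂.integrand (Set.pi Set.univ (fun _ : Fin d => Set.Icc (0:ℝ) 1)) := by
    refine ContinuousOn.congr (f := fun y : Fin d → ℝ =>
      (1 - y (Fin.castLE hd 0)) * w (fun l => y (Fin.castLE hd l))) ?_ fun y hy => ?_
    · exact (continuous_const.sub (continuous_apply _)).continuousOn.mul hwM
    · rw [hh₂i y hy, hr₁i]
  have hh₂S : IsSemialgebraicFunOn ℚ (Set.pi Set.univ (fun _ : Fin d => Set.Icc (0:ℝ) 1))
      h₂.integrand := by
    rw [← hh₂d]; exact h₂.isSemialgebraicFunOn_integrand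
  -- (C3) merge on the `d`-cube: `H = [□^d, h₁ + h₂]` has value `0`, killed by `K(≤ d)`
  obtain ⟨H, hHd, hHi⟩ := derivMarg_exists_rep (hh₁S.fun_add hh₂S) (hh₁C.add hh₂C)
  have e8 : of H - of h₁ - of h₂ ∈ relations :=
    integrandAddRel_subset_relations ⟨d, H, h₁, h₂, hh₁d.trans hHd.symm, hh₂d.trans hHd.symm,
      fun y _ => by simp only [hHi, Pi.add_apply], rfl⟩
  have eC : of g₁ + of g₂ - of H ∈ relations := by
    have hx : of g₁ + of g₂ - of H = (of g₁ - of G₁) + (of G₁ - of T₁) - (of h₁ - of T₁) +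
        ((of g₂ - of L₂) - (of r₂ - of L₂) + (of r₂ - of r₁) + (of r₁ - of h₂)) -
        (of H - of h₁ - of h₂) := by abel
    rw [hx]
    exact relations.sub_mem (relations.add_mem (relations.sub_mem (relations.add_mem eG e6) eT)
      (relations.add_mem (relations.add_mem (relations.sub_mem e5 e4) e3) e7)) e8
  have hHval : H.value = 0 := by
    have k1 := relations_le_ker_eval_holds e1
    have k2 := relations_le_ker_eval_holds e2
    have k := relations_le_ker_eval_holds eC
    simp only [AddMonoidHom.mem_ker, map_sub, eval_of, hval, ht'val] at k1
    simp only [AddMonoidHom.mem_ker, map_sub, map_add, eval_of] at k2 k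
    linarith
  have hHC : ContinuousOn H.integrand H.domain := by
    rw [hHd, hHi]; exact hh₁C.add hh₂C
  have key : of t - of t' =
      (of t - of t' - of u) + (of u - of g₁ - of g₂) + (of g₁ + of g₂ - of H) + of H := by abel
  rw [key]
  exact relations.add_mem (relations.add_mem (relations.add_mem e1 e2) eC)
    (hK d le_rfl H hHd hHC hHval)

end Summit.KontsevichZagierPeriods.KontsevichZagierPeriods.Cruxes.CubeKernelStep.Layers

end
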